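import Mathlib
import Literature.AlgebraicGeometry.Resolution.CobordantGame
import Summits.ResolutionOfSingularities.ResolutionOfSingularities.Theorems.WeightedInvariantLocalWeightedDropWildDoublePointMonicCut
import Summits.ResolutionOfSingularities.ResolutionOfSingularities.Theorems.WeightedInvariantLocalWeightedDropSepTerminalDoublePointsDim

/-!
# The wild residual W4 at order 2 is the game on the NON-TERMINAL char-2 monic double points (a typed cut, every dimension)

[OURS · L1 W4.3 · chain w43, stub worker 4 (gen 4)] Engine crux `LocalWeightedDrop` (stmt-ResolutionOfSingularities-8899), skeleton v30:
residual stubs W4|₄ `stub_wildWideApexFourStartsWon` / W4|₅₊ `stub_wildWideApexFiveUpStartsWon`.  NOT a statement of any manuscript.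

Stub worker 4's cut `wildWideApexHigherStartsWon_two_of_monicForms` (p507316) reduced the `d = 2` slice of W4 (then `p = 2`) to the
char-2 MONIC DOUBLE POINTS `y² + A₁ y + A₀` (`A_i ∈ k⟦x₀,…,x_{n+2}⟧`, `ord A₀ ≥ 3`, `ord A₁ ≥ 2`).  The TERMINAL ones — coefficient ideal
`(A₀, A₁²)` principal monomial or small residual: (M1) `A₀ = x^μ U`, `U(0) ≠ 0`, `μ ∉ 2ℕ`, `A₁ = x^{⌈μ/2⌉} B`; (M2) `A₁ = x^ν V`, `V(0) ≠ 0`,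
`A₀ = x^{2ν} W`; (SR) `A₀ = x^{2μ} g`, `ord g = 1`, `A₁ = x^μ B` — are now TREE THEOREMS in every dimension
(`SepTerminalDoublePointDim.sepTerminalDoublePointWon`, with `TerminalDoublePointDim.terminalDoublePointWon` as the `B = 0` cases).  Hence:

`wildWideApexHigherStartsWon_two_of_nonterminalMonicForms` / `wildWideApexFourStartsWon_two_of_nonterminalMonicForms`: the `d = 2` slice of
W4|_{n+4} (resp. W4|₄) follows from the winnability of the NON-TERMINAL char-2 monic double points alone — the honest frontier of this slice
is the REDUCTION GAME (reach a terminal shape), i.e. the purely inseparable / Artin–Schreier threefold-and-up double points of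
characteristic `2`.  A TYPED CUT for the planners, not a proof of the stub.
-/

set_option linter.dupNamespace false -- mandated namespace of this single-conjunct summit

namespace Summit.ResolutionOfSingularities.ResolutionOfSingularities.Theorems

open Literature.AlgebraicGeometry.Resolution Literature.AlgebraicGeometry.Resolution.CobordantGame

/-- **W4 ∩ {d = 2} FROM THE NON-TERMINAL CHAR-2 MONIC DOUBLE POINTS** (every `N = n + 4 ≥ 4`): if every NON-terminal monic double point
`y² + A₁ y + A₀` over `k⟦x_0,…,x_{n+2}⟧` (`ord A₀ ≥ 3`, `ord A₁ ≥ 2`, `(A₀, A₁)` in none of the shapes (M1)/(M2)/(SR)) is won in `n + 4`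
variables (given the singular germs in fewer variables), then the `d = 2` slice of W4|_{n+4} holds — the terminal ones are won by
`SepTerminalDoublePointDim.sepTerminalDoublePointWon`. [OURS · L1 W4.3; a cut WITH AN EXTRA HYPOTHESIS] -/
theorem wildWideApexHigherStartsWon_two_of_nonterminalMonicForms
    (hnt : ∀ (k : Type) [Field k] [CharP k 2] [IsAlgClosed k] (n : ℕ),
      (∀ m : ℕ, m < n + 4 → ∀ g : MvPowerSeries (Fin m) k,
        CobordantGame.IsSingular k g → CobordantGame.Won k m g) →
      ∀ (A₀ A₁ : MvPowerSeries (Fin (n + 3)) k), (2 : ℕ∞) < A₀.order → (1 : ℕ∞) < A₁.order →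
        ¬ ((∃ (μ : Fin (n + 3) → ℕ) (U B : MvPowerSeries (Fin (n + 3)) k), MvPowerSeries.constantCoeff U ≠ 0 ∧ ¬ (∀ l, 2 ∣ μ l) ∧
              A₀ = (∏ l, MvPowerSeries.X l ^ μ l) * U ∧ A₁ = (∏ l, MvPowerSeries.X l ^ ((μ l + 1) / 2)) * B) ∨
            (∃ (ν : Fin (n + 3) → ℕ) (V W : MvPowerSeries (Fin (n + 3)) k), MvPowerSeries.constantCoeff V ≠ 0 ∧
              A₁ = (∏ l, MvPowerSeries.X l ^ ν l) * V ∧ A₀ = (∏ l, MvPowerSeries.X l ^ (2 * ν l)) * W) ∨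
            (∃ (μ : Fin (n + 3) → ℕ) (g B : MvPowerSeries (Fin (n + 3)) k), g.order = 1 ∧
              A₀ = (∏ l, MvPowerSeries.X l ^ (2 * μ l)) * g ∧ A₁ = (∏ l, MvPowerSeries.X l ^ μ l) * B)) →
        CobordantGame.Won k (n + 4) (MvPowerSeries.X (Fin.last (n + 3)) ^ 2 +
          (MvPowerSeries.rename (Fin.succAboveEmb (Fin.last (n + 3))) A₀ +
            MvPowerSeries.rename (Fin.succAboveEmb (Fin.last (n + 3))) A₁ * MvPowerSeries.X (Fin.last (n + 3))))) :
    ∀ (p : ℕ), p.Prime → ∀ (k : Type) [Field k] [CharP k p] [IsAlgClosed k]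
      (n : ℕ), (∀ m : ℕ, m < n + 4 → ∀ g : MvPowerSeries (Fin m) k,
        CobordantGame.IsSingular k g → CobordantGame.Won k m g) →
      ∀ (f : MvPowerSeries (Fin (n + 4)) k), CobordantGame.IsSingular k f →
      (∀ g : MvPowerSeries (Fin (n + 4)) k, CobordantGame.IsSingular k g → g.order < f.order →
        CobordantGame.Won k (n + 4) g) →
      f.order = 2 → p ∣ 2 →
      (∃ ℓ : Fin (n + 4) → k, ∀ i j : Fin (n + 4),
        MvPowerSeries.coeff (Finsupp.single i 1 + Finsupp.single j 1) f =
          MvPowerSeries.coeff (Finsupp.single i 1 + Finsupp.single j 1)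
            ((∑ l, MvPowerSeries.C (ℓ l) * MvPowerSeries.X l) ^ 2)) →
      CobordantGame.Won k (n + 4) f :=
  wildWideApexHigherStartsWon_two_of_monicForms (fun k _ _ _ n IH A₀ A₁ h₀ h₁ => by
    by_cases hT : (∃ (μ : Fin (n + 3) → ℕ) (U B : MvPowerSeries (Fin (n + 3)) k), MvPowerSeries.constantCoeff U ≠ 0 ∧
          ¬ (∀ l, 2 ∣ μ l) ∧ A₀ = (∏ l, MvPowerSeries.X l ^ μ l) * U ∧ A₁ = (∏ l, MvPowerSeries.X l ^ ((μ l + 1) / 2)) * B) ∨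
        (∃ (ν : Fin (n + 3) → ℕ) (V W : MvPowerSeries (Fin (n + 3)) k), MvPowerSeries.constantCoeff V ≠ 0 ∧
          A₁ = (∏ l, MvPowerSeries.X l ^ ν l) * V ∧ A₀ = (∏ l, MvPowerSeries.X l ^ (2 * ν l)) * W) ∨
        (∃ (μ : Fin (n + 3) → ℕ) (g B : MvPowerSeries (Fin (n + 3)) k), g.order = 1 ∧
          A₀ = (∏ l, MvPowerSeries.X l ^ (2 * μ l)) * g ∧ A₁ = (∏ l, MvPowerSeries.X l ^ μ l) * B)
    · exact SepTerminalDoublePointDim.sepTerminalDoublePointWon k (m := n + 2) A₀ A₁ hT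
    · exact hnt k n IH A₀ A₁ h₀ h₁ hT)

/-- **The `N = 4` instance**: W4|₄ ∩ {d = 2} (char-2 threefold double points) follows from the winnability of the NON-TERMINAL char-2
monic double points `y² + A₁(x₀,x₁,x₂) y + A₀(x₀,x₁,x₂)` — the terminal ones (`sepTerminalDoublePointWon_four`, `terminalDoublePointWon_four`)
are tree theorems. [OURS · L1 W4.3; a cut WITH AN EXTRA HYPOTHESIS] -/
theorem wildWideApexFourStartsWon_two_of_nonterminalMonicForms
    (hnt : ∀ (k : Type) [Field k] [CharP k 2] [IsAlgClosed k],
      (∀ m : ℕ, m < 4 → ∀ g : MvPowerSeries (Fin m) k,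
        CobordantGame.IsSingular k g → CobordantGame.Won k m g) →
      ∀ (A₀ A₁ : MvPowerSeries (Fin 3) k), (2 : ℕ∞) < A₀.order → (1 : ℕ∞) < A₁.order →
        ¬ ((∃ (μ : Fin 3 → ℕ) (U B : MvPowerSeries (Fin 3) k), MvPowerSeries.constantCoeff U ≠ 0 ∧ ¬ (∀ l, 2 ∣ μ l) ∧
              A₀ = (∏ l, MvPowerSeries.X l ^ μ l) * U ∧ A₁ = (∏ l, MvPowerSeries.X l ^ ((μ l + 1) / 2)) * B) ∨
            (∃ (ν : Fin 3 → ℕ) (V W : MvPowerSeries (Fin 3) k), MvPowerSeries.constantCoeff V ≠ 0 ∧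
              A₁ = (∏ l, MvPowerSeries.X l ^ ν l) * V ∧ A₀ = (∏ l, MvPowerSeries.X l ^ (2 * ν l)) * W) ∨
            (∃ (μ : Fin 3 → ℕ) (g B : MvPowerSeries (Fin 3) k), g.order = 1 ∧
              A₀ = (∏ l, MvPowerSeries.X l ^ (2 * μ l)) * g ∧ A₁ = (∏ l, MvPowerSeries.X l ^ μ l) * B)) →
        CobordantGame.Won k 4 (MvPowerSeries.X (Fin.last 3) ^ 2 +
          (MvPowerSeries.rename (Fin.succAboveEmb (Fin.last 3)) A₀ +
            MvPowerSeries.rename (Fin.succAboveEmb (Fin.last 3)) A₁ * MvPowerSeries.X (Fin.last 3)))) :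
    ∀ (p : ℕ), p.Prime → ∀ (k : Type) [Field k] [CharP k p] [IsAlgClosed k],
      (∀ m : ℕ, m < 4 → ∀ g : MvPowerSeries (Fin m) k,
        CobordantGame.IsSingular k g → CobordantGame.Won k m g) →
      ∀ (f : MvPowerSeries (Fin 4) k), CobordantGame.IsSingular k f →
      (∀ g : MvPowerSeries (Fin 4) k, CobordantGame.IsSingular k g → g.order < f.order →
        CobordantGame.Won k 4 g) →
      f.order = 2 → p ∣ 2 →
      (∃ ℓ : Fin 4 → k, ∀ i j : Fin 4,
        MvPowerSeries.coeff (Finsupp.single i 1 + Finsupp.single j 1) f =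
          MvPowerSeries.coeff (Finsupp.single i 1 + Finsupp.single j 1)
            ((∑ l, MvPowerSeries.C (ℓ l) * MvPowerSeries.X l) ^ 2)) →
      CobordantGame.Won k 4 f :=
  wildWideApexFourStartsWon_two_of_monicForms (fun k _ _ _ IH A₀ A₁ h₀ h₁ => by
    by_cases hT : (∃ (μ : Fin 3 → ℕ) (U B : MvPowerSeries (Fin 3) k), MvPowerSeries.constantCoeff U ≠ 0 ∧
          ¬ (∀ l, 2 ∣ μ l) ∧ A₀ = (∏ l, MvPowerSeries.X l ^ μ l) * U ∧ A₁ = (∏ l, MvPowerSeries.X l ^ ((μ l + 1) / 2)) * B) ∨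
        (∃ (ν : Fin 3 → ℕ) (V W : MvPowerSeries (Fin 3) k), MvPowerSeries.constantCoeff V ≠ 0 ∧
          A₁ = (∏ l, MvPowerSeries.X l ^ ν l) * V ∧ A₀ = (∏ l, MvPowerSeries.X l ^ (2 * ν l)) * W) ∨
        (∃ (μ : Fin 3 → ℕ) (g B : MvPowerSeries (Fin 3) k), g.order = 1 ∧
          A₀ = (∏ l, MvPowerSeries.X l ^ (2 * μ l)) * g ∧ A₁ = (∏ l, MvPowerSeries.X l ^ μ l) * B)
    · exact sepTerminalDoublePointWon_four k A₀ A₁ hT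
    · exact hnt k IH A₀ A₁ h₀ h₁ hT)

end Summit.ResolutionOfSingularities.ResolutionOfSingularities.Theorems
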